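import Literature.NumberTheory.GaloisRepresentations.HomDualIdeleReadout
import Literature.NumberTheory.GaloisRepresentations.IdeleReadoutBaseChange
import Literature.NumberTheory.GaloisRepresentations.IdeleBarHomOfLocalHoms
import HarnessLib

/-!
# THE idèle projections `π_v : J̄ = lim→_E J_E → K̄_vˣ` at every place `v` (door-c6 g17's datum
# `HomDual.IdeleProjection K v`, constructed): the limit of door-c5's layer readouts
# (Milne ADT I Lemma 4.13 (proof); Tate, C–F VII §9.7)

Topic `NumberTheory/GaloisRepresentations`; namespace `Literature.NumberTheory.GaloisRepresentations.IdeleReadout`.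
Definitions with bodies and theorems; NO named fact, no `sorry`, no instance, no notation; number fields in `Type`.

THE CONSTRUCTION ((R-def) of FINDING-door-c6-g16 §5 / FINDING-door-c6-g17 §2).  `J̄ = (ideleData K).toSystem.limit` is
the direct limit over the finite Galois layers `E ⊆ K̄` of `J_E` along the idèle base changes (door-c5 g15/g16).  At a
finite place `v` the layer readouts `π_v^{E} = idelePlaceReadout v (E ⊆ K̄) : J_E → K̄_vˣ` ("the `w_v`-component followed
by `E_{w_v} → K̄_v`", door-c5 g17) are compatible with base change (`idelePlaceReadout_ideleBaseChange`, previous file),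
hence descend to **`finIdelePi v : J̄ →+ K̄_vˣ`** (`AddCommGroup.DirectLimit.lift`); it is `res_v`-equivariant
(`idelePlaceReadout_smul` + `galRestrict_layerEmb : d|_E = E.restrictHom (res_v d)`) and is `ι_v` on principal idèles
(`idelePlaceReadout_principal`), i.e. it is an idèle projection **`finIdeleProjection v : HomDual.IdeleProjection K (inr v)`**.
The same at infinite places (`ideleInfPlaceReadout`, `archIdeleProjection`), and by cases
**`ideleProjection K : ∀ v : Place K, HomDual.IdeleProjection K v`** — the family `π` consumed by door-c6's
`poitouTate_selmerStructure_duality_of_assembly` / `…_of_localTerms`.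

Also: the layer formulas `finIdelePi_of` / `archIdelePi_of` (`π_v [x]_E = π_v^{E} x`) and
**`finIdelePi_layerLift`** / **`archIdelePi_layerLift`**: for a `U_E`-trivial `X : C_Γ` and `f : X ⟶ J̄`,
`π_v (f x) = π_v^{E} (layerLift E f x)` — the bridge from the limit readout to door-c5 g17's layer assembly
(`exists_ideleBarD_hom_of_localHoms`, `idelePlaceReadout_layerLift_ideleBarHomOfLocalHoms`).

HONEST FRAMING: a construction; no case of Poitou–Tate or BSD is proved here.

## References
* J. S. Milne, *Arithmetic Duality Theorems* (2nd ed. 2006), I Lemma 4.13 (proof), I §0. [MilneADT2006]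
* J. W. S. Cassels, A. Fröhlich (eds.), *Algebraic Number Theory* (1967), Ch. VII (Tate) §9.7, Ch. II §14. [CasselsFrohlichANT1967]
* D. Harari, *Galois Cohomology and Class Field Theory* (2020), §13.1. [Harari2020]
-/

noncomputable section

open NumberField NumberField.InfinitePlace IsDedekindDomain Field CategoryTheory
open Literature.NumberTheory.Automorphic
open scoped Classical

namespace Literature.NumberTheory.GaloisRepresentations

namespace IdeleReadout

open SemiLocal ArchHerbrand DiscreteGaloisModule IdeleClassBar HomDual Literature.Algebra.Homology

variable {K : Type} [Field K] [NumberField K]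

/-! ## §1. Finite places -/

section Finite

variable (v : HeightOneSpectrum (𝓞 K))

/-- The layer readout `π_v^{E} : J_E → K̄_vˣ` of the layer `E` (door-c5 g17's `idelePlaceReadout` for `E ⊆ K̄`).
[cite: MilneADT2006, I Lemma 4.13 (proof)] -/
def finLayerReadout (E : GalLayer K) : (ideleData K).V E →+ UnitsCarrier (v.adicCompletion K) :=
  haveI := E.numberField
  haveI := E.isGalois
  idelePlaceReadout v (layerEmb E)

/-- Unfolding. [cite: MilneADT2006, I Lemma 4.13 (proof)] -/
theorem finLayerReadout_apply (E : GalLayer K) (x : (ideleData K).V E) :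
    finLayerReadout v E x = (haveI := E.numberField; haveI := E.isGalois; idelePlaceReadout v (layerEmb E) x) := rfl

/-- **The layer readouts are compatible with the base changes of `ideleData`.** [cite: MilneADT2006, I Lemma 4.13 (proof)]
[cite: CasselsFrohlichANT1967, Ch. II §14] -/
theorem finLayerReadout_base {E E' : GalLayer K} (h : E ≤ E') (x : (ideleData K).V E) :
    finLayerReadout v E' ((ideleData K).base h x) = finLayerReadout v E x := by
  haveI := E.numberField
  haveI := E'.numberField
  haveI := E.isGalois
  haveI := E'.isGalois
  letI := GalLayer.algebraOfLE h
  haveI := GalLayer.isScalarTower_of_le h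
  obtain ⟨y, rfl⟩ := (Additive.ofMul : ideleGroup E.1 ≃ _).surjective x
  exact idelePlaceReadout_ideleBaseChange v (layerEmb E) (layerEmb E') (fun _ => rfl) y

/-- **`π_v : J̄ → K̄_vˣ` at a finite place** — the limit of the layer readouts. [cite: MilneADT2006, I Lemma 4.13 (proof)]
[cite: CasselsFrohlichANT1967, Ch. VII §9.7] -/
def finIdelePi : (ideleData K).toSystem.limit →+ UnitsCarrier (v.adicCompletion K) :=
  AddCommGroup.DirectLimit.lift _ _ _ (fun E : GalLayer K => finLayerReadout v E)
    fun _ _ h x => finLayerReadout_base v h x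

/-- **`π_v [x]_E = π_v^{E} x`.** [cite: MilneADT2006, I Lemma 4.13 (proof)] -/
theorem finIdelePi_of (E : GalLayer K) (x : (ideleData K).V E) :
    finIdelePi v ((ideleData K).toSystem.of E x) =
      (haveI := E.numberField; haveI := E.isGalois; idelePlaceReadout v (layerEmb E) x) := by
  unfold finIdelePi GalLayerSystem.of
  rw [AddCommGroup.DirectLimit.lift_of]
  rfl

/-- **`π_v` is `res_v`-equivariant.** [cite: MilneADT2006, I Lemma 4.13 (proof)] [cite: CasselsFrohlichANT1967, Ch. VII §1.1] -/
theorem finIdelePi_rep (σ : absoluteGaloisGroup (v.adicCompletion K)) (z : (ideleData K).toSystem.limit) :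
    finIdelePi v ((ideleData K).toSystem.rep (absGaloisRestrict K (v.adicCompletion K) σ) z) =
      units (v.adicCompletion K) σ (finIdelePi v z) := by
  obtain ⟨E, x, rfl⟩ := (ideleData K).toSystem.exists_of z
  haveI := E.numberField
  haveI := E.isGalois
  obtain ⟨y, rfl⟩ := (Additive.ofMul : ideleGroup E.1 ≃ _).surjective x
  rw [GalLayerSystem.rep_of, finIdelePi_of, finIdelePi_of, ← galRestrict_layerEmb E v σ]
  exact idelePlaceReadout_smul v (layerEmb E) σ y

/-- **`π_v` is `ι_v` on principal idèles**: `π_v ∘ (K̄ˣ → J̄) = ι_v ∘ (lim→ Eˣ ≃ K̄ˣ)`. [cite: MilneADT2006, I §0]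
[cite: CasselsFrohlichANT1967, Ch. VII §8] -/
theorem finIdelePi_unitsToIdele (u : (unitsData K).toSystem.limit) :
    finIdelePi v ((unitsToIdele K).limitMap u) =
      unitsTransferAddHom K (v.adicCompletion K) (unitsBarAddEquiv K u) := by
  obtain ⟨E, x, rfl⟩ := (unitsData K).toSystem.exists_of u
  haveI := E.numberField
  haveI := E.isGalois
  rw [GalLayerData.Hom.limitMap_of, finIdelePi_of]
  apply unitsVal_injective
  apply Units.ext
  rw [unitsVal_unitsTransferAddHom, Units.coe_map, MonoidHom.coe_coe]
  change (unitsVal (v.adicCompletion K) (idelePlaceReadout v (layerEmb E)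
    (Additive.ofMul (IdeleHerbrand.principal E.1 (Additive.toMul x : (E.1)ˣ)))) : AlgebraicClosure (v.adicCompletion K)) =
      absClosureEmbedding K (v.adicCompletion K)
        ((Additive.toMul (unitsBarToUnits K ((unitsData K).toSystem.of E x)) : (AlgebraicClosure K)ˣ) : AlgebraicClosure K)
  rw [coe_unitsVal_idelePlaceReadout_principal, coe_toMul_unitsBarToUnits_of]
  rfl

/-- **The idèle projection at a finite place** (door-c6's datum `HomDual.IdeleProjection K (inr v)`, constructed).
[cite: MilneADT2006, I Lemma 4.13 (proof)] -/
def finIdeleProjection : HomDual.IdeleProjection K (Sum.inr v) where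
  toAddMonoidHom := finIdelePi v
  map_rep' := finIdelePi_rep v
  map_unitsToIdele' := finIdelePi_unitsToIdele v

/-- Unfolding. [cite: MilneADT2006, I Lemma 4.13 (proof)] -/
@[simp] theorem finIdeleProjection_toAddMonoidHom : (finIdeleProjection v).toAddMonoidHom = finIdelePi v := rfl

/-- **The limit readout through a layer lift**: for a `U_E`-trivial `X` and `f : X ⟶ J̄`,
`π_v (f x) = π_v^{E} (layerLift E f x)`. [cite: MilneADT2006, I Lemma 4.13 (proof)] [cite: Harari2020, §13.1] -/
theorem finIdelePi_layerLift (E : GalLayer K) {X : DiscreteRepCat ℤ (absoluteGaloisGroup K)}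
    (hX : ∀ σ ∈ E.openNormalSubgroup, ∀ x : X.obj.V, X.obj.ρ σ x = x) (f : X ⟶ ideleBarD K) (x : X.obj.V) :
    finIdelePi v (f.hom.hom x) =
      (haveI := E.numberField; haveI := E.isGalois;
        idelePlaceReadout v (layerEmb E) ((ideleData K).layerLift E hX f x)) := by
  rw [← finIdelePi_of v E, GalLayerData.of_layerLift]

end Finite

/-! ## §2. Infinite places -/

section Infinite

variable (v : InfinitePlace K)

/-- The layer readout `π_v^{E} : J_E → K̄_vˣ` at an infinite place (door-c5 g17's `ideleInfPlaceReadout`).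
[cite: MilneADT2006, I Lemma 4.13 (proof)] -/
def archLayerReadout (E : GalLayer K) : (ideleData K).V E →+ UnitsCarrier v.Completion :=
  haveI := E.numberField
  haveI := E.isGalois
  ideleInfPlaceReadout v (layerEmb E)

/-- Unfolding. [cite: MilneADT2006, I Lemma 4.13 (proof)] -/
theorem archLayerReadout_apply (E : GalLayer K) (x : (ideleData K).V E) :
    archLayerReadout v E x = (haveI := E.numberField; haveI := E.isGalois; ideleInfPlaceReadout v (layerEmb E) x) := rfl

/-- **Compatibility with base change** at an infinite place. [cite: MilneADT2006, I Lemma 4.13 (proof)]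
[cite: CasselsFrohlichANT1967, Ch. II §14] -/
theorem archLayerReadout_base {E E' : GalLayer K} (h : E ≤ E') (x : (ideleData K).V E) :
    archLayerReadout v E' ((ideleData K).base h x) = archLayerReadout v E x := by
  haveI := E.numberField
  haveI := E'.numberField
  haveI := E.isGalois
  haveI := E'.isGalois
  letI := GalLayer.algebraOfLE h
  haveI := GalLayer.isScalarTower_of_le h
  obtain ⟨y, rfl⟩ := (Additive.ofMul : ideleGroup E.1 ≃ _).surjective x
  exact ideleInfPlaceReadout_ideleBaseChange v (layerEmb E) (layerEmb E') (fun _ => rfl) y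

/-- **`π_v : J̄ → K̄_vˣ` at an infinite place.** [cite: MilneADT2006, I Lemma 4.13 (proof)] [cite: CasselsFrohlichANT1967, Ch. VII §9.7] -/
def archIdelePi : (ideleData K).toSystem.limit →+ UnitsCarrier v.Completion :=
  AddCommGroup.DirectLimit.lift _ _ _ (fun E : GalLayer K => archLayerReadout v E)
    fun _ _ h x => archLayerReadout_base v h x

/-- **`π_v [x]_E = π_v^{E} x`** at an infinite place. [cite: MilneADT2006, I Lemma 4.13 (proof)] -/
theorem archIdelePi_of (E : GalLayer K) (x : (ideleData K).V E) :
    archIdelePi v ((ideleData K).toSystem.of E x) =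
      (haveI := E.numberField; haveI := E.isGalois; ideleInfPlaceReadout v (layerEmb E) x) := by
  unfold archIdelePi GalLayerSystem.of
  rw [AddCommGroup.DirectLimit.lift_of]
  rfl

/-- **`π_v` is `res_v`-equivariant** at an infinite place. [cite: MilneADT2006, I Lemma 4.13 (proof)] -/
theorem archIdelePi_rep (σ : absoluteGaloisGroup v.Completion) (z : (ideleData K).toSystem.limit) :
    archIdelePi v ((ideleData K).toSystem.rep (absGaloisRestrict K v.Completion σ) z) =
      units v.Completion σ (archIdelePi v z) := by
  obtain ⟨E, x, rfl⟩ := (ideleData K).toSystem.exists_of z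
  haveI := E.numberField
  haveI := E.isGalois
  obtain ⟨y, rfl⟩ := (Additive.ofMul : ideleGroup E.1 ≃ _).surjective x
  rw [GalLayerSystem.rep_of, archIdelePi_of, archIdelePi_of, ← galRestrictField_layerEmb E v.Completion σ]
  exact ideleInfPlaceReadout_smul v (layerEmb E) σ y

/-- **`π_v` is `ι_v` on principal idèles** at an infinite place. [cite: MilneADT2006, I §0] -/
theorem archIdelePi_unitsToIdele (u : (unitsData K).toSystem.limit) :
    archIdelePi v ((unitsToIdele K).limitMap u) = unitsTransferAddHom K v.Completion (unitsBarAddEquiv K u) := by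
  obtain ⟨E, x, rfl⟩ := (unitsData K).toSystem.exists_of u
  haveI := E.numberField
  haveI := E.isGalois
  rw [GalLayerData.Hom.limitMap_of, archIdelePi_of]
  apply unitsVal_injective
  apply Units.ext
  rw [unitsVal_unitsTransferAddHom, Units.coe_map, MonoidHom.coe_coe]
  change (unitsVal v.Completion (ideleInfPlaceReadout v (layerEmb E)
    (Additive.ofMul (IdeleHerbrand.principal E.1 (Additive.toMul x : (E.1)ˣ)))) : AlgebraicClosure v.Completion) =
      absClosureEmbedding K v.Completion
        ((Additive.toMul (unitsBarToUnits K ((unitsData K).toSystem.of E x)) : (AlgebraicClosure K)ˣ) : AlgebraicClosure K)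
  rw [coe_unitsVal_ideleInfPlaceReadout_principal, coe_toMul_unitsBarToUnits_of]
  rfl

/-- **The idèle projection at an infinite place** (`HomDual.IdeleProjection K (inl v)`, constructed).
[cite: MilneADT2006, I Lemma 4.13 (proof)] -/
def archIdeleProjection : HomDual.IdeleProjection K (Sum.inl v) where
  toAddMonoidHom := archIdelePi v
  map_rep' := archIdelePi_rep v
  map_unitsToIdele' := archIdelePi_unitsToIdele v

/-- Unfolding. [cite: MilneADT2006, I Lemma 4.13 (proof)] -/
@[simp] theorem archIdeleProjection_toAddMonoidHom : (archIdeleProjection v).toAddMonoidHom = archIdelePi v := rfl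

/-- **The limit readout through a layer lift** at an infinite place. [cite: MilneADT2006, I Lemma 4.13 (proof)] -/
theorem archIdelePi_layerLift (E : GalLayer K) {X : DiscreteRepCat ℤ (absoluteGaloisGroup K)}
    (hX : ∀ σ ∈ E.openNormalSubgroup, ∀ x : X.obj.V, X.obj.ρ σ x = x) (f : X ⟶ ideleBarD K) (x : X.obj.V) :
    archIdelePi v (f.hom.hom x) =
      (haveI := E.numberField; haveI := E.isGalois;
        ideleInfPlaceReadout v (layerEmb E) ((ideleData K).layerLift E hX f x)) := by
  rw [← archIdelePi_of v E, GalLayerData.of_layerLift]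

end Infinite

/-! ## §3. All places -/

variable (K) in
/-- **THE idèle projections `π_v : J̄ → K̄_vˣ`, `v` any place of `K`** (door-c6 g17's `π : ∀ v, IdeleProjection K v`).
[cite: MilneADT2006, I Lemma 4.13 (proof)] [cite: CasselsFrohlichANT1967, Ch. VII §9.7] -/
def ideleProjection : (v : Place K) → HomDual.IdeleProjection K v
  | Sum.inl v => archIdeleProjection v
  | Sum.inr v => finIdeleProjection v

/-- At a finite place `ideleProjection` is `finIdelePi`. [cite: MilneADT2006, I Lemma 4.13 (proof)] -/
@[simp] theorem ideleProjection_inr_toAddMonoidHom (v : HeightOneSpectrum (𝓞 K)) :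
    (ideleProjection K (Sum.inr v)).toAddMonoidHom = finIdelePi v := rfl

/-- At an infinite place `ideleProjection` is `archIdelePi`. [cite: MilneADT2006, I Lemma 4.13 (proof)] -/
@[simp] theorem ideleProjection_inl_toAddMonoidHom (v : InfinitePlace K) :
    (ideleProjection K (Sum.inl v)).toAddMonoidHom = archIdelePi v := rfl

/-! ## §4. Layer compatibility in the shape consumed by the reciprocity-sum assembly (appended) -/

/-- **Layer compatibility of THE idèle projection at a finite place**: `π_{inr v} [x]_E = π_v^{E} x` for every layer
`E` and `x ∈ J_E` (`[x]_E = (ideleData K).toSystem.of E x`). [cite: MilneADT2006, I Lemma 4.13 (proof)] -/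
theorem ideleProjection_inr_of (v : HeightOneSpectrum (𝓞 K)) (E : GalLayer K) (x : (ideleData K).V E) :
    (ideleProjection K (Sum.inr v)).toAddMonoidHom ((ideleData K).toSystem.of E x) =
      (haveI := E.numberField; haveI := E.isGalois; idelePlaceReadout v (layerEmb E) x) :=
  finIdelePi_of v E x

/-- **Layer compatibility at an infinite place**: `π_{inl v} [x]_E = π_v^{E} x`. [cite: MilneADT2006, I Lemma 4.13 (proof)] -/
theorem ideleProjection_inl_of (v : InfinitePlace K) (E : GalLayer K) (x : (ideleData K).V E) :
    (ideleProjection K (Sum.inl v)).toAddMonoidHom ((ideleData K).toSystem.of E x) =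
      (haveI := E.numberField; haveI := E.isGalois; ideleInfPlaceReadout v (layerEmb E) x) :=
  archIdelePi_of v E x

/-- **THE idèle projection through a layer lift**, finite place: `π_{inr v} (f x) = π_v^{E} (layerLift E f x)` for a
`U_E`-trivial `X` and `f : X ⟶ J̄`. [cite: MilneADT2006, I Lemma 4.13 (proof)] [cite: Harari2020, §13.1] -/
theorem ideleProjection_inr_layerLift (v : HeightOneSpectrum (𝓞 K)) (E : GalLayer K)
    {X : DiscreteRepCat ℤ (absoluteGaloisGroup K)} (hX : ∀ σ ∈ E.openNormalSubgroup, ∀ x : X.obj.V, X.obj.ρ σ x = x)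
    (f : X ⟶ ideleBarD K) (x : X.obj.V) :
    (ideleProjection K (Sum.inr v)).toAddMonoidHom (f.hom.hom x) =
      (haveI := E.numberField; haveI := E.isGalois;
        idelePlaceReadout v (layerEmb E) ((ideleData K).layerLift E hX f x)) :=
  finIdelePi_layerLift v E hX f x

/-- The same at an infinite place. [cite: MilneADT2006, I Lemma 4.13 (proof)] [cite: Harari2020, §13.1] -/
theorem ideleProjection_inl_layerLift (v : InfinitePlace K) (E : GalLayer K)
    {X : DiscreteRepCat ℤ (absoluteGaloisGroup K)} (hX : ∀ σ ∈ E.openNormalSubgroup, ∀ x : X.obj.V, X.obj.ρ σ x = x)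
    (f : X ⟶ ideleBarD K) (x : X.obj.V) :
    (ideleProjection K (Sum.inl v)).toAddMonoidHom (f.hom.hom x) =
      (haveI := E.numberField; haveI := E.isGalois;
        ideleInfPlaceReadout v (layerEmb E) ((ideleData K).layerLift E hX f x)) :=
  archIdelePi_layerLift v E hX f x

/-- **The value of `π_{inr v} ∘ f` through a layer in one line**: for `f : X ⟶ J̄` out of a `U_E`-trivial `X`,
`unitsVal (π_{inr v} (f x)) = placeEmb v (E ⊆ K̄) ((layerLift E f x)_{w_v})`. [cite: MilneADT2006, I Lemma 4.13 (proof)] -/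
theorem coe_unitsVal_ideleProjection_inr_layerLift (v : HeightOneSpectrum (𝓞 K)) (E : GalLayer K)
    {X : DiscreteRepCat ℤ (absoluteGaloisGroup K)} (hX : ∀ σ ∈ E.openNormalSubgroup, ∀ x : X.obj.V, X.obj.ρ σ x = x)
    (f : X ⟶ ideleBarD K) (x : X.obj.V) :
    (unitsVal (v.adicCompletion K) ((ideleProjection K (Sum.inr v)).toAddMonoidHom (f.hom.hom x)) :
        AlgebraicClosure (v.adicCompletion K)) =
      (haveI := E.numberField; haveI := E.isGalois;
        placeEmb v (layerEmb E) (((Additive.toMul ((ideleData K).layerLift E hX f x) : ideleGroup E.1) :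
          AdeleRing (𝓞 E.1) E.1).2 ((embPlace v (layerEmb E) : Place K E.1 v) : HeightOneSpectrum (𝓞 E.1)))) := by
  haveI := E.numberField
  haveI := E.isGalois
  rw [ideleProjection_inr_layerLift v E hX f x]
  exact coe_unitsVal_idelePlaceReadout v (layerEmb E) _

end IdeleReadout

end Literature.NumberTheory.GaloisRepresentations

end
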